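import Literature.Probability.RandomPlanarGeometry.LoewnerInverse
import Literature.Probability.RandomPlanarGeometry.LoewnerGrowth
import HarnessLib

/-!
# The inverse Loewner maps: cocycle and small-time displacement

Trunk T-STOCH. Two deterministic facts about the inverse maps `fₜ = gₜ⁻¹ : ℍₒ → Hₜ`
(`Literature.Probability.RandomPlanarGeometry.Loewner.loewnerInv`, `Literature/Probability/RandomPlanarGeometry/LoewnerInverse.lean`) of
the chordal Loewner chain driven by a continuous `W : ℝ≥0 → ℝ`, used in the deterministic part
of the proof of Rohde–Schramm's Theorem 3.6 (Lawler, *Conformally Invariant Processes in the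
Plane* (2005), Lemma 4.33; Rohde–Schramm, *Basic properties of SLE* (2005), proof of Thm. 3.6,
eq. (3.23): `f̂ₜ = f̂_{t̂} ∘ g_{t̂} ∘ f̂ₜ`):

* `loewnerInv_add` — the **inverse cocycle** `f_{t+r} = fₜ ∘ f^{W(t+·)}_r` on `ℍₒ` (inverse of
  Lawler's `g_{t+r} = g^{W(t+·)}_r ∘ gₜ`, `Literature.Probability.RandomPlanarGeometry.Loewner.map_add` of `LoewnerGrowth`);
* `norm_loewnerInv_sub_self_le` — the **small-time displacement bound** `|fₜ(z) - z| ≤ 2t / im z`: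
  along the backward flow `ḣ = -2/(h - W(t-u))` the imaginary part does not decrease
  (`im_le_im_bwd`), so `|ḣ| ≤ 2 / im z`.

## References

* G. F. Lawler, *Conformally Invariant Processes in the Plane*, AMS (2005), Rem. 4.9 (cocycle),
  Thm. 4.6 and Rem. 4.8 (backward flow), Lemma 4.33.
* S. Rohde, O. Schramm, *Basic properties of SLE*, Ann. of Math. 161 (2005), proof of Thm. 3.6,
  eq. (3.23).
-/

noncomputable section

open Set Filter Topology Metric Complex
open UpperHalfPlane (upperHalfPlaneSet isOpen_upperHalfPlaneSet)
open scoped NNReal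

namespace Literature.Probability.RandomPlanarGeometry

namespace Loewner

variable {W : ℝ≥0 → ℝ} {z : ℂ}

/-- **The inverse cocycle**: `f_{t+r}(z) = fₜ (f^{W(t+·)}_r (z))` for `z ∈ ℍₒ` (from the
forward cocycle `g_{t+r} = g^{W(t+·)}_r ∘ gₜ`, Lawler (2005), Rem. 4.9, and the bijections
`gₛ : Hₛ → ℍₒ`). [cite: Lawler2005, Rem. 4.9] -/
theorem loewnerInv_add (hW : Continuous W) (t r : ℝ≥0) (hz : 0 < z.im) :
    loewnerInv W (t + r) z = loewnerInv W t (loewnerInv (fun u ↦ W (t + u)) r z) := by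
  set V : ℝ≥0 → ℝ := fun u ↦ W (t + u) with hV
  have hVc : Continuous V := continuous_shift W hW t
  set x := loewnerInv W (t + r) z with hx
  have hxd : x ∈ domain W (t + r) := loewnerInv_mem_domain hW (t + r) hz
  have hxT : ((t + r : ℝ≥0) : WithTop ℝ≥0) < swallowingTime W x := ((mem_domain_iff W _ x).1 hxd).2
  have hxt : x ∈ domain W t := (mem_domain_iff W t x).2 ⟨((mem_domain_iff W _ x).1 hxd).1,
    lt_of_le_of_lt (by exact_mod_cast (le_self_add : t ≤ t + r)) hxT⟩
  obtain ⟨hrT, hmap⟩ := map_add hW hxT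
  have hgz : map W (t + r) x = z := map_loewnerInv hW (t + r) hz
  -- `gₜ x ∈ H^V_r` and `g^V_r (gₜ x) = z`, so `f^V_r z = gₜ x`
  have hgt : map W t x ∈ domain V r :=
    (mem_domain_iff V r _).2 ⟨mapsTo_map hW t hxt, hrT⟩
  have hfV : loewnerInv V r z = map W t x :=
    invFunOn_map_eq hVc hz hgt (by rw [← hmap, hgz])
  rw [hfV, loewnerInv_map hW hxt]

/-- **Small-time displacement of the inverse map**: `|fₜ(z) - z| ≤ 2t / im z` for `z ∈ ℍₒ`
(the backward flow `h` from `z` has `|ḣ| = 2/|h - W(t-u)| ≤ 2/im h ≤ 2/im z`, `im_le_im_bwd`).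
[cite: Lawler2005, Thm. 4.6 (proof) and Rem. 4.8] -/
theorem norm_loewnerInv_sub_self_le (hW : Continuous W) (t : ℝ≥0) (hz : 0 < z.im) :
    ‖loewnerInv W t z - z‖ ≤ 2 / z.im * t := by
  have hd := hasDerivWithinAt_bwd hW t hz
  have hbound : ∀ u ∈ Ico (0 : ℝ) t, ‖-vectorField W ((t : ℝ) - u) (bwd W t z u)‖ ≤ 2 / z.im := by
    intro u hu
    have him := im_le_im_bwd hW t hz u (Ico_subset_Icc_self hu)
    have hpos : 0 < (bwd W t z u).im := hz.trans_le him
    rw [norm_neg, vectorField_apply, norm_div, RCLike.norm_ofNat]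
    have h1 : (bwd W t z u).im ≤ ‖bwd W t z u - W (((t : ℝ) - u).toNNReal)‖ := by
      have := Complex.abs_im_le_norm (bwd W t z u - W (((t : ℝ) - u).toNNReal))
      rwa [Complex.sub_im, Complex.ofReal_im, sub_zero, abs_of_pos hpos] at this
    exact div_le_div_of_nonneg_left (by norm_num) hz (him.trans h1)
  have h := norm_image_sub_le_of_norm_deriv_le_segment' hd hbound t (right_mem_Icc.2 t.coe_nonneg)
  rwa [bwd_self hW t hz, bwd_zero hW t hz, sub_zero] at h

/-- The displacement bound with the time on the left: `|fₜ(z) - z| ≤ 2t / im z`. [folklore] -/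
theorem norm_loewnerInv_sub_self_le' (hW : Continuous W) (t : ℝ≥0) (hz : 0 < z.im) :
    ‖loewnerInv W t z - z‖ ≤ 2 * t / z.im := by
  have := norm_loewnerInv_sub_self_le hW t hz
  rwa [div_mul_eq_mul_div] at this

/-- **The imaginary part of `fₜ(z)`**: `im z ≤ im fₜ(z)` (`im_le_im_bwd` at the endpoint).
[folklore] -/
theorem im_le_im_loewnerInv (hW : Continuous W) (t : ℝ≥0) (hz : 0 < z.im) :
    z.im ≤ (loewnerInv W t z).im := by
  have := im_le_im_bwd hW t hz t (right_mem_Icc.2 t.coe_nonneg)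
  rwa [bwd_self hW t hz] at this

end Loewner

end Literature.Probability.RandomPlanarGeometry
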